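import Summits.BirchSwinnertonDyer.BirchSwinnertonDyer.Theorems.GenusKolyvaginAtTwoMinimalTwinBSDTwoSwappedPairLossless
import Summits.BirchSwinnertonDyer.BirchSwinnertonDyer.Theses.GenusKolyvaginAtTwo
import HarnessLib

/-!
# Route `GenusKolyvaginAtTwo`, crux U₂ `MinimalTwinBSDTwo` (stmt-BirchSwinnertonDyer-22985), LINE 23 «twin_swap» v1.2:
# THE `2`-PRIMITIVITY CLAUSE OF STUB S2′ FOLLOWS FROM THE LEAF — census shape S2″ ⟹ S2′ modulo leaf + PRINT

Seat `bsd-line-gk2-p3` g28 (PROVER seat 3/3, cell `bsd-f1-sign2`), `--supports stmt-BirchSwinnertonDyer-22985` (helper; closes nothing).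
THEOREMS ONLY (no definition, no named fact, no `sorry`); standard axioms.  **BSD is NOT proved by this file; U₂ / hTw / S2′ are NOT
proved; no item is closed.**  Everything here is CONDITIONAL on the leaf `Rank1Residual.NonCMAtTwo` (what the route wants to prove) and on
the route's four PRINT items `GrossZagierAllLevels` (24148), `EntireLFunctionRat` (19273), `MultPublishedInputsAtTwo` (19921), `MilneAnyModel`
(24149) — a losslessness certificate in ROUTE CURRENCY, the `ε = −1` twin of gk2-p5 g34's `GenusSupplyNarrow.Lossless.K1_of_nonCMAtTwo`
(p763825).  The per-datum engine is gk2-p2 g23's `TwinSwap.not_exists_two_smul_derivedPoint_of_bsdp_of_facts` (`…SwappedPairLossless`,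
landed 2026-08-30 ≈07:47Z, cited BY NAME, not restated): on LINE 23's budget slice `BSD₂(E) ∧ BSD₂(Wd)` + PRINT force `P(1) ∉ 2E(K[1])`.

* §1 **`not_twoDiv_derivedPoint_of_nonCMAtTwo`** — on the swapped frame (`W` non-CM of analytic rank `1`, `#Sel₂(E) = 2`, `C(E)` odd; `K`
  imaginary quadratic, `d_K` odd `≠ −3`, Heegner; `Dt.c` odd; `P(1)` of infinite order; `Wd` a globally minimal model of `E^(d_K)` with
  `#Sel₂(Wd) = 1` inside the genus budget `(Δ_E < 0 ∧ ord₂ C(Wd) ≤ 1) ∨ ord₂ C(Wd) = 0`): **the leaf + PRINT ⟹ `P(1) ∉ 2E(K[1])`**.  This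
  file supplies the two `BSD₂` the engine needs FROM THE LEAF: `BSD₂(E)` (`E` non-CM of analytic rank `1 ≤ 1`) and `BSD₂(Wd)` (the twin
  is non-CM — same `j` — of analytic rank `0 ≤ 1`: `r_an(Wd) = 0` by g23's `analyticRank_twist_eq_zero_of_rankOne`, i.e.
  `L′(E/K,1) = L′(E,1)·L(E^(d_K),1) ≠ 0`).
* §2 **`reversedSupply_primitive_of_nonCMAtTwo`** — THE CENSUS READING FOR LINE 23: modulo the leaf and the four PRINT items, S2′ is
  EQUIVALENT to S2″ := S2′ WITHOUT the `2`-primitivity clause («a budget-admissible Heegner field `K` with `d_K` odd `≠ −3`, an odd-Manin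
  datum, `y_K` of infinite order and a globally minimal `2`-Selmer-TRIVIAL twin»): the clause carries no slack and no over-claim; the
  beyond-print content of LINE 23 that EXCEEDS the leaf sits only in S2″ (reversed twin supply), S1 (the rank-`0` wall) and S4 (the
  even-Tamagawa cell `Δ < 0`, `ord₂ C = 1` of `…TamagawaSlices`).  Stated on the ∃-shape of g23's v1.2 stub text (binders verbatim); a
  refuter should not spend probes on the clause.  The unconditional reading of the clause (Heegner index odd) and its BSD-inconsistency
  off the odd slice are in the sibling file `…SwappedPairHeegnerIndex`.

References: [GrossZagier1986] I.(6.3), V.§2 (2.2); [GrossLMS1991] §2 (2.2), §4; [McCallumLMS1991] §5 Lemma 5.1; [Milne1972ArithmeticAV]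
§1 Thm. 1; [Kramer1981] Thm. 1; [Miller2011LMS] Def. 1.1.
-/

set_option autoImplicit false
set_option linter.dupNamespace false -- `Summit.<P>.<Sub>` repeats `BirchSwinnertonDyer` (D-0017)

noncomputable section

open scoped Classical

open WeierstrassCurve NumberField Literature.NumberTheory.EllipticCurves
  Literature.NumberTheory.EllipticCurves.ModularForms
  Literature.NumberTheory.EllipticCurves.Rank1Residual
  Literature.NumberTheory.EllipticCurves.Rank1Residual.Typed
  Literature.NumberTheory.EllipticCurves.KrizLi2019
  Summit.BirchSwinnertonDyer.Rank1Residual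
  Summit.BirchSwinnertonDyer.Rank1Residual.AdditivePotMult
  Summit.BirchSwinnertonDyer.BirchSwinnertonDyer.Rank1Residual
  Summit.BirchSwinnertonDyer.BirchSwinnertonDyer.Theses.GenusKolyvaginAtTwo
  Summit.BirchSwinnertonDyer.BirchSwinnertonDyer.Theorems.CMExactDescent

namespace Summit.BirchSwinnertonDyer.BirchSwinnertonDyer.Theorems.GenusExact.TwinSwap.LosslessOfLeaf

/-! ## §1 LOSSLESSNESS in route currency: the leaf forces the clause -/

/-- **`P(1) ∉ 2E(K[1])` FROM THE LEAF, on every swapped frame inside the budget** (route currency: the leaf `NonCMAtTwo` and the route's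
four PRINT items `GrossZagierAllLevels`, `EntireLFunctionRat`, `MultPublishedInputsAtTwo`, `MilneAnyModel`).  `W` non-CM of analytic rank
`1` gives `BSD₂(E)` from the leaf; the twin `Wd` is non-CM (same `j`) of analytic rank `0` (`L′(E/K,1) = L′(E,1)·L(E^(d_K),1) ≠ 0`, g23's
`analyticRank_twist_eq_zero_of_rankOne`), so `BSD₂(Wd)` from the leaf; then gk2-p2 g23's per-datum engine
`TwinSwap.not_exists_two_smul_derivedPoint_of_bsdp_of_facts` (cited by name).
CONDITIONAL on the leaf (what the route wants to prove) — a losslessness statement, not progress on BSD.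
[cite: GrossZagier1986, I.(6.3), V.§2 (2.2)] [cite: Milne1972ArithmeticAV, §1 Thm. 1] [cite: Miller2011LMS, Def. 1.1] -/
theorem not_twoDiv_derivedPoint_of_nonCMAtTwo
    (hleaf : NonCMAtTwo) (hGZ : GrossZagierAllLevels) (hL : EntireLFunctionRat) (hGZK : MultPublishedInputsAtTwo) (hMi : MilneAnyModel)
    (W : WeierstrassCurve ℚ) [W.IsElliptic] [W.IsGloballyMinimal] [NeZero (W.conductorNorm ℤ)]
    (hcm : ¬ W.HasCM) (hr : W.analyticRank = 1) (hSel : Nat.card (W.selmerGroup 2) = 2) (hT : Odd W.tamagawaProduct)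
    (K : Type) [Field K] [NumberField K] (hK : IsImaginaryQuadratic K) (hodd : Odd (NumberField.discr K))
    (h3 : NumberField.discr K ≠ -3) (hH : SatisfiesHeegnerHypothesis (W.conductorNorm ℤ) K)
    (Dt : ModularParametrizationData W (W.conductorNorm ℤ)) (hc : Odd Dt.c) (β : ℤ) (ι : K →+* ℂ)
    (d₁ : KolyvaginHeegnerData Dt β ι 1) (hy : ¬ IsOfFinAddOrder d₁.derivedPoint)
    (Wd : WeierstrassCurve ℚ) [Wd.IsElliptic] [Wd.IsGloballyMinimal]
    (hWd : ∃ C : VariableChange ℚ, C • W.quadraticTwist (NumberField.discr K : ℚ) = Wd)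
    (hSel1 : Nat.card (Wd.selmerGroup 2) = 1)
    (hbudget : (W.Δ < 0 ∧ padicValNat 2 Wd.tamagawaProduct ≤ 1) ∨ padicValNat 2 Wd.tamagawaProduct = 0) :
    ¬ ∃ Q : (W.baseChange (ringClassField K ι 1)).toAffine.Point, (2 : ℤ) • Q = d₁.derivedPoint := by
  haveI hEK : (W.baseChange K).IsElliptic := isElliptic_baseChange' W K
  have hD0 : (NumberField.discr K : ℚ) ≠ 0 := by exact_mod_cast NumberField.discr_ne_zero K
  haveI hEt : (W.quadraticTwist (NumberField.discr K : ℚ)).IsElliptic := W.isElliptic_quadraticTwist hD0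
  obtain ⟨Cd, hCd⟩ := hWd
  -- `BSD₂(E)` from the leaf
  have hBW : BSDp W 2 := hleaf W hcm (by rw [hr])
  -- the twin is non-CM (same `j`) of analytic rank `0`, so `BSD₂(Wd)` from the leaf
  have hcmd : ¬ Wd.HasCM := by
    rw [← hCd, hasCM_iff_of_j_eq (((W.quadraticTwist (NumberField.discr K : ℚ)).variableChange_j Cd).trans (W.j_quadraticTwist hD0))]
    exact hcm
  obtain ⟨P₀, Hd, hP₀, hP₀K⟩ := exists_heegnerPoint_map_eq_derivedPoint_one hK hH d₁
  have hPinf : ¬ IsOfFinAddOrder P₀ := by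
    intro hfin
    apply hy
    rw [← hP₀K]
    exact (WeierstrassCurve.Affine.Point.map (W' := W)
      (algebraMap K (ringClassField K ι 1)).toRatAlgHom).isOfFinAddOrder hfin
  have hrt : (W.quadraticTwist (NumberField.discr K : ℚ)).analyticRank = 0 :=
    analyticRank_twist_eq_zero_of_rankOne W K (hGZ _ W K) hL hK hH hr ⟨Dt, Hd, ι, hP₀⟩ hPinf
  have hrd : Wd.analyticRank = 0 := by rw [← hCd, analyticRank_smul, hrt]
  have hBd : BSDp Wd 2 := hleaf Wd hcmd (by rw [hrd]; exact zero_le_one)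
  exact not_exists_two_smul_derivedPoint_of_bsdp_of_facts hGZ hGZK hL hMi W hr hSel hT K hK hodd h3 hH Dt hc β ι d₁ hy Wd
    ⟨Cd, hCd⟩ hSel1 hbudget hBd hBW

/-! ## §2 Census reading for LINE 23: S2′ ⟺ S2″ modulo the leaf and PRINT -/

/-- **S2″ ⟹ S2′ MODULO THE LEAF AND PRINT** — the `2`-primitivity clause of LINE 23's stub S2′ (`ReversedMinimalSupplyAtTwoDepthZero`,
v1.2 ∃-shape of gk2-p2 g23's memo, binders verbatim) carries no slack: for `W` non-CM of analytic rank `1` with `#Sel₂(E) = 2` and `C(E)`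
odd, IF some budget-admissible Heegner field `K` (`d_K` odd `≠ −3`), odd-Manin datum `Dt`, conductor-`1` datum with `P(1)` of infinite order
and globally minimal `2`-Selmer-trivial twin `Wd ≅ E^(d_K)` exist (S2″), THEN the same data satisfy S2′ (with `P(1) ∉ 2E(K[1])`), given the
leaf and the four PRINT items (§1).  The converse S2′ ⟹ S2″ is trivial.  So modulo leaf + PRINT the research content of LINE 23 beyond the
leaf is S2″ (the REVERSED `2`-Selmer-trivial Heegner twin supply), S1 (the rank-`0` wall) and S4 (even `C(E)`) — not the primitivity clause.
CONDITIONAL on the leaf; BSD is NOT proved by this; U₂ is NOT proved; nothing is closed.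
[cite: GrossZagier1986, V.§2 (2.2)] [cite: McCallumLMS1991, §5 Lemma 5.1] [cite: Miller2011LMS, Def. 1.1] -/
theorem reversedSupply_primitive_of_nonCMAtTwo
    (hleaf : NonCMAtTwo) (hGZ : GrossZagierAllLevels) (hL : EntireLFunctionRat) (hGZK : MultPublishedInputsAtTwo) (hMi : MilneAnyModel) :
    ∀ (W : WeierstrassCurve ℚ) [W.IsElliptic] [W.IsGloballyMinimal] [NeZero (W.conductorNorm ℤ)],
      ¬ W.HasCM → W.analyticRank = 1 → Nat.card (W.selmerGroup 2) = 2 → Odd W.tamagawaProduct →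
      (∃ (K : Type) (_ : Field K) (_ : NumberField K),
        IsImaginaryQuadratic K ∧ Odd (NumberField.discr K) ∧ NumberField.discr K ≠ -3 ∧
        SatisfiesHeegnerHypothesis (W.conductorNorm ℤ) K ∧
        ∃ (Dt : ModularParametrizationData W (W.conductorNorm ℤ)) (β : ℤ) (ι : K →+* ℂ) (d₁ : KolyvaginHeegnerData Dt β ι 1),
          Odd Dt.c ∧ ¬ IsOfFinAddOrder d₁.derivedPoint ∧
          ∃ (Wd : WeierstrassCurve ℚ) (_ : Wd.IsElliptic) (_ : Wd.IsGloballyMinimal),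
            (∃ C : WeierstrassCurve.VariableChange ℚ, C • W.quadraticTwist (NumberField.discr K : ℚ) = Wd) ∧
            Nat.card (Wd.selmerGroup 2) = 1 ∧
            ((W.Δ < 0 ∧ padicValNat 2 Wd.tamagawaProduct ≤ 1) ∨ padicValNat 2 Wd.tamagawaProduct = 0)) →
      ∃ (K : Type) (_ : Field K) (_ : NumberField K),
        IsImaginaryQuadratic K ∧ Odd (NumberField.discr K) ∧ NumberField.discr K ≠ -3 ∧
        SatisfiesHeegnerHypothesis (W.conductorNorm ℤ) K ∧
        ∃ (Dt : ModularParametrizationData W (W.conductorNorm ℤ)) (β : ℤ) (ι : K →+* ℂ) (d₁ : KolyvaginHeegnerData Dt β ι 1),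
          Odd Dt.c ∧ ¬ IsOfFinAddOrder d₁.derivedPoint ∧
          (¬ ∃ Q : (W.baseChange (ringClassField K ι 1)).toAffine.Point, (2 : ℤ) • Q = d₁.derivedPoint) ∧
          ∃ (Wd : WeierstrassCurve ℚ) (_ : Wd.IsElliptic) (_ : Wd.IsGloballyMinimal),
            (∃ C : WeierstrassCurve.VariableChange ℚ, C • W.quadraticTwist (NumberField.discr K : ℚ) = Wd) ∧
            Nat.card (Wd.selmerGroup 2) = 1 ∧
            ((W.Δ < 0 ∧ padicValNat 2 Wd.tamagawaProduct ≤ 1) ∨ padicValNat 2 Wd.tamagawaProduct = 0) := by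
  intro W _ _ _ hcm hr hSel hT hS2
  obtain ⟨K, iF, iN, hK, hodd, h3, hH, Dt, β, ι, d₁, hc, hy, Wd, iE, iM, hWd, hSel1, hbudget⟩ := hS2
  have hprim : ¬ ∃ Q : (W.baseChange (ringClassField K ι 1)).toAffine.Point, (2 : ℤ) • Q = d₁.derivedPoint :=
    not_twoDiv_derivedPoint_of_nonCMAtTwo hleaf hGZ hL hGZK hMi W hcm hr hSel hT K hK hodd h3 hH Dt hc β ι d₁ hy Wd hWd hSel1 hbudget
  exact ⟨K, iF, iN, hK, hodd, h3, hH, Dt, β, ι, d₁, hc, hy, hprim, Wd, iE, iM, hWd, hSel1, hbudget⟩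


end Summit.BirchSwinnertonDyer.BirchSwinnertonDyer.Theorems.GenusExact.TwinSwap.LosslessOfLeaf

end
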